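import Summits.NavierStokesRegularity.NavierStokesRegularity.Theorems.DirectionEnergyUntwistedAncientLiouvilleRepr
import Literature.Analysis.FluidPDE.BarkerPrange2020VorticityAlignmentTypeIHolds
import HarnessLib

/-!
# Route DirectionEnergy, item `UntwistedAncientLiouville` — III: per-slice globalisation of the vorticity direction

Helper file for item stmt-NavierStokesRegularity-2893 (`DirectionEnergy.UntwistedAncientLiouville`).
The item's hypothesis is LOCAL: the vorticity direction `ξ = ω/‖ω‖` has zero derivative
wherever `ω = curl v(t) ≠ 0`. The Giga–Miura architecture needs the GLOBAL form "`ω(t)` is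
everywhere parallel to one vector". The passage is by real-analyticity of the slices:

* `analyticOnNhd_slice_of_ancient` — every slice of a jointly continuous bounded ancient mild
  solution in the tree's duality form is real-analytic on `ℝ³` (Lemarié-Rieusset 2016, Thm. 9.12,
  PROVED in the tree as `lemarieRieusset2016_local_analyticity_holds`, transported to the class
  through the Oseen-mild representative of file I and `oseenMild_bounded_unique`);
* `curl_parallel_of_fderiv_direction_eq_zero_of_analytic` — for an analytic field, `∇ξ = 0` on
  `{ω ≠ 0}` forces `ω ∥ e` globally (constancy of `ξ` on a small ball, then the identity-theorem
  globalisation `curl_parallel_of_parallel_on_open` of the tree);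
* `curl_parallel_of_fderiv_direction_eq_zero` — the two combined (brick (A) of the assembly).

## References

* P. G. Lemarié-Rieusset, *The Navier–Stokes problem in the 21st century*, CRC 2016, Thm. 9.12.
  [LemarieRieusset2016]
* Y. Giga, H. Miura, Comm. Math. Phys. 303 (2011) 289–300, Prop. 2.2. [GigaMiura2011]
-/

set_option linter.dupNamespace false

noncomputable section

open MeasureTheory Set Function Filter Module
open scoped RealInnerProductSpace ContDiff

namespace Summit.NavierStokesRegularity.NavierStokesRegularity.Theorems

namespace UntwistedAncient

open Literature.Analysis Literature.Analysis.FluidPDE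

/-- **Slices of a jointly continuous bounded ancient mild solution (duality form) are
real-analytic** (Lemarié-Rieusset 2016, Thm. 9.12: bounded mild solutions are analytic in space
and time; in the tree the PROVED local form `lemarieRieusset2016_local_analyticity_holds`). The
slice `v(t)` is, up to a Galilean change of frame and an additive constant, the slice `W(1)` of
the Oseen-mild representative of `exists_oseen_repr` on the window based at `t − 1`; `W(1)` is
identified with the slice of Lemarié-Rieusset's analytic Oseen fixed point started shortly before
(`oseenMild_bounded_unique`, then continuity). [cite: LemarieRieusset2016, Thm. 9.12 (PDF p. 260)] -/
theorem analyticOnNhd_slice_of_ancient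
    {v : ℝ → EuclideanSpace ℝ (Fin 3) → EuclideanSpace ℝ (Fin 3)}
    (hv : IsBoundedAncientMildSolution 1 v) (hcont : ContinuousOn (uncurry v) (Iio 0 ×ˢ univ))
    {t : ℝ} (ht : t < 0) : AnalyticOnNhd ℝ (v t) univ := by
  -- the window based at `a = t - 1`; `v(t)` sits at window time `1 < -a`
  set a : ℝ := t - 1 with ha_def
  have ha : a < 0 := by rw [ha_def]; linarith
  obtain ⟨W, B, N, hWm, hWN, hWs, hmild, hident⟩ := exists_oseen_repr hv hcont ha
  have h1a : (1 : ℝ) < -a := by rw [ha_def]; linarith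
  have h1win : (1 : ℝ) ∈ Ioo 0 (-a) := ⟨one_pos, h1a⟩
  -- Lemarié-Rieusset's local analytic solution from the datum `W σ₀`, `σ₀` shortly before `1`
  obtain ⟨ε, hε, C₀, hC₀, hloc⟩ := lemarieRieusset2016_local_analyticity_holds
  have hN0 : 0 ≤ N := (norm_nonneg _).trans (hWN 1 h1win 0)
  set Mb : ℝ := N + 1 with hMb
  have hMb0 : 0 < Mb := by rw [hMb]; linarith
  set ℓ : ℝ := ε * 1 / Mb ^ 2 with hℓ
  have hℓ0 : 0 < ℓ := by rw [hℓ]; positivity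
  set σ₀ : ℝ := 1 - min (1 / 2) (ℓ / 2) with hσ₀
  have hmin1 : min (1 / 2 : ℝ) (ℓ / 2) ≤ 1 / 2 := min_le_left _ _
  have hmin2 : min (1 / 2 : ℝ) (ℓ / 2) ≤ ℓ / 2 := min_le_right _ _
  have hmin0 : 0 < min (1 / 2 : ℝ) (ℓ / 2) := lt_min (by norm_num) (by linarith)
  have hσ₀0 : 0 < σ₀ := by rw [hσ₀]; linarith
  have hσ₀1 : σ₀ < 1 := by rw [hσ₀]; linarith
  have h1ℓ : (1 : ℝ) < σ₀ + ℓ := by rw [hσ₀]; linarith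
  have hσ₀win : σ₀ ∈ Ioo 0 (-a) := ⟨hσ₀0, hσ₀1.trans h1a⟩
  have ha_meas : AEStronglyMeasurable (W σ₀) volume :=
    (hWm.of_uncurry_left (x := σ₀)).aestronglyMeasurable
  have ha_bd : eLpNorm (W σ₀) ⊤ volume ≤ ENNReal.ofReal Mb := by
    rw [eLpNorm_exponent_top]
    refine eLpNormEssSup_le_of_ae_bound (Eventually.of_forall fun x => ?_)
    exact (hWN σ₀ hσ₀win x).trans (by rw [hMb]; linarith)
  obtain ⟨vl, hvl_an, hvl_eq, hvl_bd⟩ := hloc one_pos σ₀ hMb0 ha_meas ha_bd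
  -- the common window `(σ₀, T₂)`, `T₂ = min (σ₀ + ℓ) (-a) ∋ 1`
  set T₂ : ℝ := min (σ₀ + ℓ) (-a) with hT₂
  have h1T₂ : (1 : ℝ) < T₂ := lt_min h1ℓ h1a
  have hT₂h : T₂ ≤ σ₀ + ε * 1 / Mb ^ 2 := min_le_left _ _
  have hT₂a : T₂ ≤ -a := min_le_right _ _
  -- uniqueness of bounded Oseen-mild solutions on the window
  set M' : ℝ := max N (C₀ * Mb) with hM'
  have hM'0 : 0 ≤ M' := hN0.trans (le_max_left _ _)
  have hum : AEStronglyMeasurable (uncurry W)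
      ((volume : Measure (ℝ × EuclideanSpace ℝ (Fin 3))).restrict (Ioo σ₀ T₂ ×ˢ univ)) :=
    hWm.aestronglyMeasurable
  have hvm : AEStronglyMeasurable (uncurry vl)
      ((volume : Measure (ℝ × EuclideanSpace ℝ (Fin 3))).restrict (Ioo σ₀ T₂ ×ˢ univ)) :=
    (hvl_an.continuousOn.mono (prod_mono (Ioo_subset_Ioo_right hT₂h) Subset.rfl)).aestronglyMeasurable
      (measurableSet_Ioo.prod MeasurableSet.univ)
  have huM : ∀ τ ∈ Ioo σ₀ T₂, ∀ y, ‖W τ y‖ ≤ M' := fun τ hτ y =>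
    (hWN τ ⟨hσ₀0.trans hτ.1, hτ.2.trans_le hT₂a⟩ y).trans (le_max_left _ _)
  have hvM : ∀ τ ∈ Ioo σ₀ T₂, ∀ y, ‖vl τ y‖ ≤ M' := fun τ hτ y =>
    (hvl_bd τ ⟨hτ.1, hτ.2.trans_le hT₂h⟩ y).trans (le_max_right _ _)
  have hu : ∀ τ ∈ Ioo σ₀ T₂, W τ =ᵐ[volume] fun x =>
      UnboundedOperators.heatExtension (W σ₀) (1 * (τ - σ₀)) x - oseenDuhamel 1 σ₀ W W τ x :=
    fun τ hτ => Eventually.of_forall fun x => by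
      rw [one_mul]
      exact hmild σ₀ τ hσ₀0 hτ.1 (hτ.2.trans_le hT₂a) x
  have hv' : ∀ τ ∈ Ioo σ₀ T₂, vl τ =ᵐ[volume] fun x =>
      UnboundedOperators.heatExtension (W σ₀) (1 * (τ - σ₀)) x - oseenDuhamel 1 σ₀ vl vl τ x :=
    fun τ hτ => Eventually.of_forall fun x => hvl_eq τ ⟨hτ.1, hτ.2.trans_le hT₂h⟩ x
  have heq := oseenMild_bounded_unique
    (U := fun τ x => UnboundedOperators.heatExtension (W σ₀) (1 * (τ - σ₀)) x)
    one_pos hM'0 hum hvm huM hvM hu hv' 1 ⟨hσ₀1, h1T₂⟩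
  have h1w : (1 : ℝ) ∈ Ioo σ₀ (σ₀ + ε * 1 / Mb ^ 2) := ⟨hσ₀1, h1T₂.trans_le hT₂h⟩
  have hvl1 : AnalyticOnNhd ℝ (vl 1) univ := analyticOnNhd_slice hvl_an h1w
  have hW1 : W 1 = vl 1 :=
    (Continuous.ae_eq_iff_eq volume (hWs 1 h1win).continuous
      (continuousOn_univ.1 hvl1.continuousOn)).1 heq
  have hW1an : AnalyticOnNhd ℝ (W 1) univ := by rw [hW1]; exact hvl1
  -- back to `v(t)`: a Galilean change of frame and an additive constant
  have hta : (1 : ℝ) + a = t := by rw [ha_def]; ring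
  have hvt : v t = fun x => W 1 (x - B 1) + (v t 0 - W 1 (0 - B 1)) := by
    funext x
    have h := hident 1 h1win x 0
    rw [hta] at h
    rw [← sub_eq_zero]
    have : v t x - (W 1 (x - B 1) + (v t 0 - W 1 (0 - B 1))) =
        (v t x - v t 0) - (W 1 (x - B 1) - W 1 (0 - B 1)) := by abel
    rw [this, h, sub_self]
  rw [hvt]
  have hshift : AnalyticOnNhd ℝ (fun x : EuclideanSpace ℝ (Fin 3) => x - B 1) univ :=
    analyticOnNhd_id.sub analyticOnNhd_const
  exact (hW1an.comp hshift fun _ _ => mem_univ _).add analyticOnNhd_const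

/-- **A locally constant vorticity direction is globally constant on an analytic slice.** If
`V` is real-analytic on `ℝ³` and its vorticity direction `ξ = curl V/‖curl V‖` has zero
derivative wherever `curl V ≠ 0`, then either `curl V ≡ 0` or `curl V` is everywhere parallel
to one fixed non-zero vector: near a point `x₀` with `curl V x₀ ≠ 0`, `ξ` is differentiable
with zero derivative on a ball inside `{curl V ≠ 0}`, hence constant there, so `curl V ∥ ξ(x₀)`
on that ball, and the analytic globalisation `curl_parallel_of_parallel_on_open` (identity
theorem) spreads it to `ℝ³`. [cite: GigaMiura2011, Prop. 2.2 (proof: "by rotation we may assume ω = (0,0,ω₃)"); LemarieRieusset2016, Thm. 9.12 (analyticity)] -/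
theorem curl_parallel_of_fderiv_direction_eq_zero_of_analytic
    {V : EuclideanSpace ℝ (Fin 3) → EuclideanSpace ℝ (Fin 3)} (hV : AnalyticOnNhd ℝ V univ)
    (hdir : ∀ y, curl V y ≠ 0 → fderiv ℝ (vorticityDirection (curl V)) y = 0) :
    (∀ x, curl V x = 0) ∨
      ∃ e : EuclideanSpace ℝ (Fin 3), e ≠ 0 ∧ ∀ x, ∃ a : ℝ, curl V x = a • e := by
  by_cases h0 : ∀ x, curl V x = 0
  · exact Or.inl h0
  · right
    push Not at h0
    obtain ⟨x₀, hx₀⟩ := h0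
    have hc : AnalyticOnNhd ℝ (curl V) univ := analyticOnNhd_curl hV
    have hcc : Continuous (curl V) := continuousOn_univ.1 hc.continuousOn
    -- a ball around `x₀` inside the open set `{curl V ≠ 0}`
    have hopen : IsOpen {y : EuclideanSpace ℝ (Fin 3) | curl V y ≠ 0} :=
      isOpen_ne_fun hcc continuous_const
    obtain ⟨r, hr, hball⟩ := Metric.isOpen_iff.1 hopen x₀ hx₀
    -- `ξ` is differentiable with zero derivative on the ball, hence constant there
    set ξ := vorticityDirection (curl V) with hξ
    have hξdiff : ∀ y ∈ Metric.ball x₀ r, DifferentiableAt ℝ ξ y := by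
      intro y hy
      have hy' : curl V y ≠ 0 := hball hy
      have hd : DifferentiableAt ℝ (curl V) y := (hc y (mem_univ y)).differentiableAt
      have hn : DifferentiableAt ℝ (fun z => ‖curl V z‖) y := hd.norm ℝ hy'
      have hinv : DifferentiableAt ℝ (fun z => ‖curl V z‖⁻¹) y := hn.inv (norm_ne_zero_iff.2 hy')
      have : ξ = fun z => ‖curl V z‖⁻¹ • curl V z := by
        funext z; rw [hξ, vorticityDirection_apply]
      rw [this]
      exact hinv.smul hd
    have hξconst : ∀ y ∈ Metric.ball x₀ r, ξ y = ξ x₀ := fun y hy =>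
      Metric.isOpen_ball.is_const_of_fderiv_eq_zero (convex_ball x₀ r).isPreconnected
        (fun z hz => (hξdiff z hz).differentiableWithinAt) (fun z hz => hdir z (hball hz)) hy
        (Metric.mem_ball_self hr)
    -- on the ball, `curl V = ‖curl V‖ ξ(x₀)`
    have hpar : ∀ y ∈ Metric.ball x₀ r, ∃ a : ℝ, curl V y = a • ξ x₀ := by
      intro y hy
      refine ⟨‖curl V y‖, ?_⟩
      have hy' : curl V y ≠ 0 := hball hy
      have hny : ‖curl V y‖ ≠ 0 := norm_ne_zero_iff.2 hy'
      rw [← hξconst y hy, hξ, vorticityDirection_apply, smul_smul, mul_inv_cancel₀ hny, one_smul]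
    have hξ₀ : ξ x₀ ≠ 0 := by
      rw [hξ, vorticityDirection_apply]
      exact smul_ne_zero (inv_ne_zero (norm_ne_zero_iff.2 hx₀)) hx₀
    exact ⟨ξ x₀, hξ₀, curl_parallel_of_parallel_on_open hV Metric.isOpen_ball
      ⟨x₀, Metric.mem_ball_self hr⟩ hpar⟩

/-- **Brick (A) of the assembly: per-slice globalisation of the vorticity direction** for a
jointly continuous bounded ancient mild solution (duality form) whose vorticity direction has
zero derivative off the zero set at time `t < 0`: either `curl v(t) ≡ 0` or `curl v(t)` is
everywhere parallel to one non-zero vector (analyticity of the slice,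
`analyticOnNhd_slice_of_ancient`, and `curl_parallel_of_fderiv_direction_eq_zero_of_analytic`).
[cite: GigaMiura2011, Prop. 2.2 (proof); LemarieRieusset2016, Thm. 9.12] -/
theorem curl_parallel_of_fderiv_direction_eq_zero
    {v : ℝ → EuclideanSpace ℝ (Fin 3) → EuclideanSpace ℝ (Fin 3)}
    (hv : IsBoundedAncientMildSolution 1 v)
    (hcont : ContinuousOn (uncurry v) (Iio 0 ×ˢ univ))
    {t : ℝ} (ht : t < 0)
    (hdir : ∀ y, curl (v t) y ≠ 0 → fderiv ℝ (vorticityDirection (curl (v t))) y = 0) :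
    (∀ x, curl (v t) x = 0) ∨
      ∃ e : EuclideanSpace ℝ (Fin 3), e ≠ 0 ∧ ∀ x, ∃ a : ℝ, curl (v t) x = a • e :=
  curl_parallel_of_fderiv_direction_eq_zero_of_analytic (analyticOnNhd_slice_of_ancient hv hcont ht)
    hdir

end UntwistedAncient

end Summit.NavierStokesRegularity.NavierStokesRegularity.Theorems

end
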